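import Summits.BirchSwinnertonDyer.Rank1Residual.X11b.InterpolationCharacterSupply
import Literature.NumberTheory.GaloisRepresentations.WeakAbelianDirectSummandCyclotomicProofs
import HarnessLib

/-!
# A Hecke character of infinity type `(n, −n)`, `n ≠ 0`, on a totally complex field is NOT a norm
# twist (brick (f)″ of the [BRω] road R-ψ; helper file 35 for crux 2 `GoodLatticeBDPValue`,
# stmt-BirchSwinnertonDyer-19032, cell `bsd-eis` seat `bsd-eis-k5-c2`)

Tate's entire continuation (`heckeLFunction_hasEntireContinuation_of_not_isNormTwist_holds`) — and
through it the admissibility lemma `katzBranch_admissible_reflect_inv` (p491242) — asks that the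
unitary character `θ_Kφ⁻¹` is not a norm twist `‖·‖^z`. For `θ_K` of finite order (type `(0,0)`) and
`φ` anticyclotomic of type `(n, −n)`, `n ≥ 1`, the product has type `(−n, n)`; this file proves that NO
character of type `(n, −n)` with `n ≠ 0` on a totally complex `K` is a norm twist: a norm twist is
`1` on every idele of norm `1`, in particular on the infinite idele `x` all of whose coordinates are
`e^{iθ}` (norm `∏_w |e^{iθ}|^{2} = 1`), whereas the infinity type evaluates `χ(x)` to
`∏_w e^{-inθ}·e^{-inθ} = e^{−2incθ} = −1` for `θ = π/(2nc)` (`c` = number of infinite places) — the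
computation of the tree's `X11b.not_hasInfinityType_one_of_ne_zero`, verbatim, with `χ(x) = 1` now
coming from the norm-twist hypothesis instead of `χ = 1`.

* `ideleNorm_infiniteIdeles_eq_one_of_norm_eq_one` — an infinite idele all of whose coordinates have
  norm `1` has idele norm `1`;
* `not_isNormTwist_of_hasInfinityType` — the statement above;
* `not_isNormTwist_mul_inv_of_isFiniteOrder` — the consumer's form: `θ` finite order, `φ` of type
  `(n, −n)`, `n ≠ 0` ⟹ `θφ⁻¹` is not a norm twist.

Pure bookkeeping; no fact, no definition; nothing about BSD. References: Weil 1956 (type `A₀`);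
Tate 1950 Thm. 4.4.1; HOME/k5-c2-MEMO-6.md §4; HOME/k5-ty-g8/BR-OMEGA-ROAD.md §2 (f).
-/

-- the summit namespace `Summit.BirchSwinnertonDyer.BirchSwinnertonDyer` repeats the problem name by design (D-0017)
set_option linter.dupNamespace false
set_option autoImplicit false

noncomputable section

open scoped Classical ComplexConjugate

open NumberField NumberField.InfinitePlace NumberField.InfinitePlace.Completion
  Literature.NumberTheory.GaloisRepresentations Literature.NumberTheory.GaloisRepresentations.HeckeCharacter
  Literature.NumberTheory.Automorphic Summit.BirchSwinnertonDyer.Rank1Residual.X11b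

namespace Summit.BirchSwinnertonDyer.BirchSwinnertonDyer.Theorems.IwasawaTwoVariable

section NormTwist

variable {K : Type} [Field K] [NumberField K]

/-- An infinite idele all of whose coordinates have norm `1` has idele norm `1`
(`‖(x, 1)‖ = ∏_w ‖x_w‖^{[K_w : ℝ]}`). [folklore] -/
theorem ideleNorm_infiniteIdeles_eq_one_of_norm_eq_one {x : (InfiniteAdeleRing K)ˣ}
    (hx : ∀ w : InfinitePlace K, ‖(x : InfiniteAdeleRing K) w‖ = 1) :
    ideleNorm (infiniteIdeles K x) = 1 := by
  rw [ideleNorm_infiniteIdeles]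
  exact Finset.prod_eq_one fun w _ ↦ by rw [hx w, one_pow]

/-- **A Hecke character of infinity type `(n, −n)`, `n ≠ 0`, on a totally complex field is not a
norm twist.** See the module docstring: at the infinite idele with all coordinates `e^{iθ}`,
`θ = π/(2nc)`, a norm twist takes the value `1` (idele norm `1`) while the infinity type
(`HasInfinityType.apply_infiniteIdeles_eq`, every infinite idele being totally positive) gives `−1`.
[cite: Weil1956, §1 (characters of type A₀)] -/
theorem not_isNormTwist_of_hasInfinityType [IsTotallyComplex K] {χ : HeckeCharacter K} {n : ℤ}
    (hn : n ≠ 0) (h : χ.HasInfinityType (fun _ ↦ n) (fun _ ↦ -n)) : ¬ χ.IsNormTwist := by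
  classical
  rintro ⟨z, hz⟩
  set c : ℕ := Fintype.card (InfinitePlace K) with hc_def
  have hc : 0 < c := Fintype.card_pos
  -- the angle and the point `z₀ = exp(θ I)`
  set θ : ℂ := (Real.pi : ℂ) / (2 * (n : ℂ) * (c : ℂ)) with hθ_def
  set z₀ : ℂ := Complex.exp (θ * Complex.I) with hz₀_def
  have hz00 : z₀ ≠ 0 := Complex.exp_ne_zero _
  have hconjθ : conj θ = θ := by
    rw [hθ_def]
    simp [map_div₀, map_mul, Complex.conj_ofReal, map_ofNat]
  have hnormz₀ : ‖z₀‖ = 1 := by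
    rw [hz₀_def, Complex.norm_exp, Complex.mul_re, Complex.I_re, Complex.I_im, mul_zero, mul_one,
      zero_sub]
    have hθim : θ.im = 0 := by
      rw [← Complex.conj_eq_iff_im]
      exact hconjθ
    rw [hθim, neg_zero, Real.exp_zero]
  -- the ring map `ℂ → K ⊗ ℝ = Π_w K_w`
  let ρ : ℂ →+* InfiniteAdeleRing K :=
    RingHom.pi fun w : InfinitePlace K =>
      ((ringEquivComplexOfIsComplex (IsTotallyComplex.isComplex w)).symm : ℂ ≃+* w.Completion).toRingHom
  let x : (InfiniteAdeleRing K)ˣ := Units.map (ρ : ℂ →* InfiniteAdeleRing K) (Units.mk0 z₀ hz00)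
  have hxw : ∀ w : InfinitePlace K, extensionEmbedding w ((x : InfiniteAdeleRing K) w) = z₀ := by
    intro w
    show extensionEmbedding w
      ((ringEquivComplexOfIsComplex (IsTotallyComplex.isComplex w)).symm z₀) = z₀
    rw [← ringEquivComplexOfIsComplex_apply (IsTotallyComplex.isComplex w), RingEquiv.apply_symm_apply]
  have hnormx : ∀ w : InfinitePlace K, ‖(x : InfiniteAdeleRing K) w‖ = 1 := fun w ↦ by
    rw [← (isometry_extensionEmbedding w).norm_map_of_map_zero (map_zero _), hxw w, hnormz₀]
  have hpos : InfiniteIdele.IsTotallyPositive x := fun w hw =>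
    absurd hw (not_isReal_iff_isComplex.mpr (IsTotallyComplex.isComplex w))
  -- the norm twist is `1` at `x`; the infinity type says `archFactor`
  have key := h.apply_infiniteIdeles_eq hpos
  rw [hz (infiniteIdeles K x), ideleNorm_infiniteIdeles_eq_one_of_norm_eq_one hnormx] at key
  push_cast at key
  rw [Complex.one_cpow, HeckeCharacter.archFactor_apply] at key
  simp_rw [hxw] at key
  rw [Finset.prod_const, Finset.card_univ, ← hc_def] at key
  -- compute the factor: `z₀^{-n} · conj(z₀)^{n} = exp(-2 n θ I)`
  have hconj : conj z₀ = Complex.exp (-(θ * Complex.I)) := by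
    rw [hz₀_def, ← Complex.exp_conj, map_mul, hconjθ, Complex.conj_I, mul_neg]
  have hfac : z₀ ^ (-n) * conj z₀ ^ (- -n) = Complex.exp (-(2 * (n : ℂ) * θ * Complex.I)) := by
    rw [neg_neg, hconj, hz₀_def, ← Complex.exp_int_mul, ← Complex.exp_int_mul, ← Complex.exp_add]
    congr 1
    simp only [Int.cast_neg]
    ring
  rw [hfac, ← Complex.exp_nat_mul] at key
  -- `c · (-(2 n θ I)) = -π I`
  have hn' : (n : ℂ) ≠ 0 := Int.cast_ne_zero.mpr hn
  have hc' : (c : ℂ) ≠ 0 := Nat.cast_ne_zero.mpr hc.ne'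
  have harg : (c : ℂ) * -(2 * (n : ℂ) * θ * Complex.I) = -(Real.pi : ℂ) * Complex.I := by
    rw [hθ_def]
    field_simp
  rw [harg, neg_mul, Complex.exp_neg, Complex.exp_pi_mul_I] at key
  norm_num at key

/-- **The consumer's form**: `θ` of finite order and `φ` of infinity type `(n, −n)` with `n ≠ 0` on a
totally complex `K` ⟹ `θφ⁻¹` (type `(−n, n)`) is not a norm twist — the hypothesis `hnt` of
`katzBranch_admissible_reflect_inv`. [cite: Weil1956, §1] -/
theorem not_isNormTwist_mul_inv_of_isFiniteOrder [IsTotallyComplex K] {θ φ : HeckeCharacter K}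
    (hθ : θ.IsFiniteOrder) {n : ℤ} (hn : n ≠ 0)
    (hφ : φ.HasInfinityType (fun _ ↦ n) (fun _ ↦ -n)) : ¬ (θ * φ⁻¹).IsNormTwist := by
  have hinf : (θ * φ⁻¹).HasInfinityType (fun _ ↦ -n) (fun _ ↦ -(-n)) := by
    have h := (Three.LambdaSupply.hasInfinityType_zero_of_isFiniteOrder hθ).mul' hφ.inv
    convert h using 2 <;> simp
  exact not_isNormTwist_of_hasInfinityType (neg_ne_zero.mpr hn) hinf

end NormTwist

end Summit.BirchSwinnertonDyer.BirchSwinnertonDyer.Theorems.IwasawaTwoVariable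

end
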